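import Summits.NavierStokesRegularity.NavierStokesRegularity.Theses.PalasekTowerBreakdown
import Summits.NavierStokesRegularity.FluidComputer.PalasekTowerRegisterGlobalEnvelopeAt

/-!
# NavierStokesRegularity — route `PalasekTowerBreakdown`, item `HeredityAtOne`: the lossless split into its two halves

Supports `stmt-NavierStokesRegularity-19249` (`HeredityAtOne`, the first rung of the split crux
`EpisodeInduction` — the hand-over `1 → 2`, `N₁ = 256^{1.1} ≈ 445 → N₂ ≈ 819`, unforced after `τ₁`;
it does NOT close it and nobody claims it). Cell `ns-blowup`, seat `ns-blowup-ecbridge-7`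
(literature-prover; D-0074 GROUP C «BRIDGE SUPPORT»; director-ns RE-POINT 2026-08-26T03:36:55Z).
LABEL: E–C typing (pure glue over landed register theorems, by name on the route decls). WHAT THIS IS
NOT: not NS — no stage, tower or instance is constructed; the item and its halves are OPEN and appear
only inside equivalences / implications.

The sibling child `HeredityFromTwo` (item 19250, levels `k ≥ 2`) was born with a BC3 line of two
halves — `ContinuationEnvelope` (UPPER: finite-energy classical continuation to the next readout
inside the next ceiling; no premature blow-up, no overshoot) and `ReadoutFloors` (LOWER: the three
floors of the next level at its readout for every such continuation) — shown LOSSLESS by ecbridge-5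
(`heredityFrom_two_iff_envelope_and_floors`, p419350). This file records the SAME split for the
first rung, against the ROUTE DECL by name, using the level-wise halves `ContinuationEnvelopeAt 1` /
`ReadoutFloorsAt 1` of `FluidComputer/PalasekTowerRegisterGlobalHalvesAt.lean` (this seat):

* `palasekTowerBreakdown_heredityAtOne_iff_envelopeAt_and_floorsAt :
  PalasekTowerBreakdown.HeredityAtOne ↔ ContinuationEnvelopeAt 1 ∧ ReadoutFloorsAt 1` — LOSSLESS with
  NO hypothesis. The delicate direction (item ⇒ lower half: an ARBITRARY finite-energy continuation
  inside the ceiling must show the floors) runs through the forced era `[0, τ₁)`, where ecbridge-5's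
  silent-window uniqueness is unavailable; it holds because a continuation inside a ceiling is the
  BOUNDED = strong solution, so the forced Serrin–Masuda weak–strong uniqueness THEOREM of the tree
  (`serrinMasuda_weak_strong_uniqueness_forced`, Sohr 2001 Thm. V.1.5.1, via ecbridge-6 g2's
  `Stage.velocity_eq_of_window_ceiling`) identifies it with the extension stage — no W14;
* the composition `palasekTowerBreakdown_heredityAtOne_of_envelopeAt_floorsAt :
  ContinuationEnvelopeAt 1 → ReadoutFloorsAt 1 → PalasekTowerBreakdown.HeredityAtOne` (what a BC3 line
  `Cruxes/HeredityAtOne/Lines/…` with stubs `continuation_envelope_at_one` / `readout_floors_at_one`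
  would register — filing a line is the planner's call, not this seat's) and the two projections;
* the `∃`-form entry `palasekTowerBreakdown_heredityAtOne_of_exists_velocity_continuation`: ONE
  finite-energy classical continuation per registered level-1 stage, agreeing with it in VELOCITY
  (any pressure gauge), inside `(5/3)·Y₂` on `[0, τ₂]` and meeting the three level-2 floors at `τ₂`,
  gives the item (the cheapest honest signature for a prover or a certificate);
* the upper half further re-typed (`FluidComputer/PalasekTowerRegisterGlobalEnvelopeAt.lean`, this
  seat): `palasekTowerBreakdown_heredityAtOne_iff_local_apriori_floors :
  PalasekTowerBreakdown.HeredityAtOne ↔ LocalContinuationAt 1 ∧ AprioriCeilingAt 1 ∧ ReadoutFloorsAt 1`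
  — «the level-1 flow crosses the end `τ₁` of the forced era» ∧ «no overshoot of `(5/3)·Y₂` before
  `τ₂`» ∧ «the level-2 floors at `τ₂`»; premature blow-up inside `(τ₁, τ₂]` is excluded by theorem
  (a-priori continuation principle) given the first two;
* the parent and the sibling in the same currency: `palasekTowerBreakdown_episodeInduction_iff_halves :
  EpisodeInduction ↔ (ContinuationEnvelopeAt 1 ∧ ReadoutFloorsAt 1) ∧ ContinuationEnvelope ∧ ReadoutFloors`,
  `palasekTowerBreakdown_heredityFromTwo_iff_forall_halvesAt :
  HeredityFromTwo ↔ ∀ k ≥ 2, ContinuationEnvelopeAt k ∧ ReadoutFloorsAt k`.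

So 19249 reads: «(E₁) every registered level-1 flow of a pinned rigid quiet wide design survives the
first unforced window `[τ₁, τ₂]` (length `(253/25)·log N₂/A₁ ≈ 5.5·10⁻⁵ = 10.9` level-1 viscous
times) classically, with finite energy, below `(5/3)·Y₂ ≈ 1.0·10⁴`» ∧ «(F₁) every such continuation
shows at `τ₂`, in the ball, speed `≥ Y₂ ≈ 6.1·10³`, strain `≥ A₂ ≈ 5.0·10⁶` and an `N₂`-core loop
(radius `1/N₂ ≈ 1.2·10⁻³`, circulation `≥ N₂^{0.3} ≈ 7.5`)»; a refutation of either half refutes the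
item (and the parent), a proof of both proves it.

References: S. Palasek, arXiv:2605.13827 §4 [cite: Palasek2026ElementaryModel, §4]; H. Sohr, *The
Navier–Stokes Equations*, Birkhäuser 2001, Ch. V Thm. 1.5.1 [cite: Sohr2001, Ch. V Thm. 1.5.1].
-/

-- `Summit.<Summit>.<Problem>` is the tree's mandated summit-side namespace (CONVENTIONS §2); for this
-- single-conjunct summit the two coincide, so the duplicate is deliberate.
set_option linter.dupNamespace false

namespace Summit.NavierStokesRegularity.NavierStokesRegularity.Theorems

open Set MeasureTheory
open scoped ENNReal ContDiff
open Literature.Analysis.FluidPDE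
open Summit.NavierStokesRegularity.NavierStokesRegularity.Theses
open Summit.NavierStokesRegularity.FluidComputer.PalasekTowerClayBridge

/-- **Item `HeredityAtOne` ⇔ its two halves — no hypothesis**:
`PalasekTowerBreakdown.HeredityAtOne ↔ ContinuationEnvelopeAt 1 ∧ ReadoutFloorsAt 1` (route decl by
name; body `heredityAtOne_iff_envelopeAt_and_floorsAt`). [cite: Sohr2001, Ch. V Thm. 1.5.1] -/
theorem palasekTowerBreakdown_heredityAtOne_iff_envelopeAt_and_floorsAt :
    PalasekTowerBreakdown.HeredityAtOne ↔ ContinuationEnvelopeAt 1 ∧ ReadoutFloorsAt 1 := by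
  unfold PalasekTowerBreakdown.HeredityAtOne
  exact heredityAtOne_iff_envelopeAt_and_floorsAt

/-- **The composition a line on item 19249 would register**: upper half + lower half at level `1` ⇒
`PalasekTowerBreakdown.HeredityAtOne`. [folklore] -/
theorem palasekTowerBreakdown_heredityAtOne_of_envelopeAt_floorsAt (hA : ContinuationEnvelopeAt 1)
    (hB : ReadoutFloorsAt 1) : PalasekTowerBreakdown.HeredityAtOne :=
  palasekTowerBreakdown_heredityAtOne_iff_envelopeAt_and_floorsAt.2 ⟨hA, hB⟩

/-- The item yields its upper half (free). [folklore] -/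
theorem palasekTowerBreakdown_heredityAtOne_continuationEnvelopeAt
    (h : PalasekTowerBreakdown.HeredityAtOne) : ContinuationEnvelopeAt 1 :=
  (palasekTowerBreakdown_heredityAtOne_iff_envelopeAt_and_floorsAt.1 h).1

/-- The item yields its lower half (no W14: forced Serrin–Masuda through the forced era).
[cite: Sohr2001, Ch. V Thm. 1.5.1] -/
theorem palasekTowerBreakdown_heredityAtOne_readoutFloorsAt
    (h : PalasekTowerBreakdown.HeredityAtOne) : ReadoutFloorsAt 1 :=
  (palasekTowerBreakdown_heredityAtOne_iff_envelopeAt_and_floorsAt.1 h).2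

/-- **The `∃`-form entry (cheapest honest signature)**: if every globally anchored registered
level-`1` stage `s` of every pinned (`Λ = 8`, `θ = 6/5`), rigid, quiet wide schedule has SOME
classical finite-energy solution `(v, q)` of the design's system on `[0, τ₂]` agreeing with `s` IN
VELOCITY on `[0, τ₁]` (any pressure gauge), below `c₂·Y₂` on `[0, τ₂]`, with at `τ₂`, in the ball,
speed `≥ c₁·Y₂` somewhere, strain `≥ c₁·A₂` somewhere and a level-`2` core loop — then
`PalasekTowerBreakdown.HeredityAtOne` (`heredityAt_of_exists_velocity_continuation` at `k = 1`).
[folklore] -/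
theorem palasekTowerBreakdown_heredityAtOne_of_exists_velocity_continuation
    (h : ∀ S : Schedule TowerRates.wide, S.Pins 8 (6 / 5) → S.Rigid → S.Quiet →
      ∀ s : Stage 1 TowerRates.wide S (Margins.routeG TowerRates.wide) 1,
        ∃ (v : ℝ → EuclideanSpace ℝ (Fin 3) → EuclideanSpace ℝ (Fin 3))
          (q : ℝ → EuclideanSpace ℝ (Fin 3) → ℝ),
          IsClassicalNSSolutionOn (Icc 0 (S.τ 2)) 1 S.f v q ∧
          (∀ t ∈ Icc 0 (S.τ 1), v t = s.u t) ∧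
          (∃ C : ℝ≥0∞, C < ⊤ ∧ ∀ t ∈ Icc 0 (S.τ 2), ∫⁻ x, ‖v t x‖ₑ ^ 2 ≤ C) ∧
          (∀ t ∈ Icc 0 (S.τ 2), ∀ x, ‖v t x‖ ≤ S.c₂ * TowerRates.wide.Y 2) ∧
          (∃ x, ‖x‖ ≤ S.radius ∧ S.c₁ * TowerRates.wide.Y 2 ≤ ‖v (S.τ 2) x‖) ∧
          (∃ x, ‖x‖ ≤ S.radius ∧
            S.c₁ * TowerRates.wide.A 2 ≤ ‖fderiv ℝ (v (S.τ 2)) x‖) ∧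
          (∃ (x : EuclideanSpace ℝ (Fin 3)) (γ : ℝ → EuclideanSpace ℝ (Fin 3)),
            ‖x‖ ≤ S.radius ∧ ContDiff ℝ 1 γ ∧ γ 0 = γ 1 ∧
            (∀ σ ∈ Icc (0 : ℝ) 1, γ σ ∈ Metric.closedBall x (1 / TowerRates.wide.N 2)) ∧
            (∀ σ ∈ Icc (0 : ℝ) 1, ‖deriv γ σ‖ ≤ 8 * Real.pi / TowerRates.wide.N 2) ∧
            S.c₁ * TowerRates.wide.N 2 ^ (TowerRates.wide.β - 2) ≤
              circulation (v (S.τ 2)) γ)) :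
    PalasekTowerBreakdown.HeredityAtOne := by
  unfold PalasekTowerBreakdown.HeredityAtOne
  exact heredityAtOne_iff.2 (heredityAt_of_exists_velocity_continuation h)

/-- **Item `HeredityAtOne` in THREE stubs — no hypothesis**:
`PalasekTowerBreakdown.HeredityAtOne ↔ LocalContinuationAt 1 ∧ AprioriCeilingAt 1 ∧ ReadoutFloorsAt 1`
(route decl by name; body `heredityAtOne_iff_local_apriori_floors`: the upper half's existence part
is a theorem once the flow crosses `τ₁` and cannot overshoot — RRS 2016 Thm. 8.17 iterated,
`exists_classical_extension_Icc_of_apriori_bound`). [cite: RobinsonRodrigoSadowski2016, Thm. 8.17] -/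
theorem palasekTowerBreakdown_heredityAtOne_iff_local_apriori_floors :
    PalasekTowerBreakdown.HeredityAtOne ↔
      LocalContinuationAt 1 ∧ AprioriCeilingAt 1 ∧ ReadoutFloorsAt 1 := by
  unfold PalasekTowerBreakdown.HeredityAtOne
  exact heredityAtOne_iff_local_apriori_floors

/-- The composition a three-stub line on item 19249 would register: local continuation across `τ₁`
+ a-priori ceiling + readout floors ⇒ `PalasekTowerBreakdown.HeredityAtOne`. [folklore] -/
theorem palasekTowerBreakdown_heredityAtOne_of_local_apriori_floors (hL : LocalContinuationAt 1)
    (hA : AprioriCeilingAt 1) (hF : ReadoutFloorsAt 1) : PalasekTowerBreakdown.HeredityAtOne :=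
  palasekTowerBreakdown_heredityAtOne_iff_local_apriori_floors.2 ⟨hL, hA, hF⟩

/-- The item pins the a-priori ceiling (no overshoot before `τ₂` of ANY finite-energy continuation
of a registered level-1 stage) — no W14. [cite: Sohr2001, Ch. V Thm. 1.5.1] -/
theorem palasekTowerBreakdown_heredityAtOne_aprioriCeilingAt
    (h : PalasekTowerBreakdown.HeredityAtOne) : AprioriCeilingAt 1 :=
  (palasekTowerBreakdown_heredityAtOne_iff_local_apriori_floors.1 h).2.1

/-- **The parent crux in four halves, no hypothesis**: `EpisodeInduction ↔ (ContinuationEnvelopeAt 1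
∧ ReadoutFloorsAt 1) ∧ ContinuationEnvelope ∧ ReadoutFloors` (route decl by name; body
`episodeInductionG_iff_halves`). [cite: Sohr2001, Ch. V Thm. 1.5.1] -/
theorem palasekTowerBreakdown_episodeInduction_iff_halves :
    PalasekTowerBreakdown.EpisodeInduction ↔
      (ContinuationEnvelopeAt 1 ∧ ReadoutFloorsAt 1) ∧ ContinuationEnvelope ∧ ReadoutFloors := by
  unfold PalasekTowerBreakdown.EpisodeInduction
  exact episodeInductionG_iff_halves

/-- **The sibling child in the same currency, no hypothesis**: `HeredityFromTwo ↔ ∀ k ≥ 2,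
ContinuationEnvelopeAt k ∧ ReadoutFloorsAt k` (route decl by name; body
`heredityFrom_iff_forall_envelopeAt_and_floorsAt` at `k₀ = 2`). [cite: Sohr2001, Ch. V Thm. 1.5.1] -/
theorem palasekTowerBreakdown_heredityFromTwo_iff_forall_halvesAt :
    PalasekTowerBreakdown.HeredityFromTwo ↔
      ∀ k : ℕ, 2 ≤ k → ContinuationEnvelopeAt k ∧ ReadoutFloorsAt k := by
  unfold PalasekTowerBreakdown.HeredityFromTwo
  exact heredityFrom_iff_forall_envelopeAt_and_floorsAt

end Summit.NavierStokesRegularity.NavierStokesRegularity.Theorems
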